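import Summits.QuantumFields.BalabanUV.T4Continuum.Support.NE7ApeCurvedRepRoadBSharp
import Summits.QuantumFields.BalabanUV.T4Continuum.Support.NE7ApeCurvedRepPointedGaugeFourTerm
import Summits.QuantumFields.BalabanUV.T4Continuum.Support.NE7GradientCurrencyCurvedSharp
import Summits.QuantumFields.BalabanUV.T4Continuum.Support.NE7RelPlaqCodifferentialBounds
import Summits.QuantumFields.BalabanUV.T4Continuum.Support.NE3AxialGaugeLadder
import HarnessLib

/-!
# NE7ApeCurvedRepRoadBGradientSharpFourTerm — O2 RE-THREAD, FILE 10: `NE7ApeCurvedRepRoadBGradientSharpH` (F123bʰ: the gradient letter α₁ DISCHARGED at Bałaban's order by the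
# sharp gradient currency F121b + E′'s reaction, tent extension, F111) RE-CUT on F157 `NE7ApeCurvedRepPointedGaugeFourTerm`: `(S, hS, hG)` ↦ the FOUR-TERM letter `h4`; the known
# gauge part `σ̃` (tent) feeds `K_Ξ·2θ_u`; the divergence datum is DISCHARGED as `d_C + (b₀ + 3c_RE b₀) + 2d·a_N` (`hDivCorr` displayed, E′'s clause, crude kinematic bound on
# F111's lift); conclusion: F123bʰ's radius `+ K_D·(d_C + (b₀ + 3c_RE b₀) + 2d·a_N) + K_Ξ·2θ_u` (file 92 of the curved (APE), F162)

Cell `pub-balaban`, rung (B)+1 sub-cell t4, lineage `b2b-balaban-t4-ne7-p1` (CRUX PROVER NE7 #1 = OWNER of row NE7), generation 82; memo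
`t4/b2b-balaban-t4-ne7-p1-g82/LOCALISATION-ROAD.md` §2 (O2).  Twin of `NE7ApeCurvedRepRoadBGradientSharpH` (gen 80) over F157; every supplier BY NAME as there.
WHY.  Penultimate link: after `…GradientM` (the line at `R = M`) and `…GradientClass` (class data only) the END of record will read: E′ regime + class data + regime lines + the
FOUR-TERM letter + ONE displayed kinematic letter `hDivCorr` (divergence of the pointing correction) — all else discharged.
WHAT ([folklore]; 0 def, 0 sorry).  **`smallField_of_tanCritical_roadB_gradientSharp_fourTerm`**.
HONEST FRAMING (page 1): composition over DISPLAYED letters (four-term letter, `hDivCorr`) and PROVED suppliers; the crude `2d·a_N` is kinematics, not a claim that it closes; nothing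
of Bałaban's asserted; (APE) on curved data NOT proved; NOT ONE-STEP, NOT NE7; spine 0∕9; finite T⁴ rung (B)+1 — NOT infinite volume, NOT mass gap, NOT `BetaPertH`, NOT Clay.
Continuum YM on T⁴ ⇐ BetaPertH ∧ nine spine estimates (0/9 proved); BetaPertH ⇐ (D1) ∧ (D4) ∧ CAP+tail; G-an2-4 gates asym, D1 and NE2/3/4.
-/

set_option autoImplicit false

open scoped BigOperators Matrix Matrix.Norms.L2Operator
open NormedSpace Finset

namespace Summit.QuantumFields.BalabanUV.T4Continuum.NE7ApeCurvedRepRoadBGradientSharpFourTerm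

open Literature.MathematicalPhysics.QuantumFieldTheory.Balaban1983to89
open B7Prop1Explicit B7Prop2Explicit MatrixLog UnitaryModel
open T4AveragingDeficitWall (Ad IsUnitaryCfg IsSkewDir SmallField vary curlAt dirL1)
open T4AveragingDeficitWallBoundary (IsPeriodicCfg periodBox)
open AveragingDeficitPeriodicCounting (IsPeriodicDir)
open AveragingDeficitTwoLevelPrep (twoLevelSmall)
open AveragingDeficitMultiLevelPrep (cavgIter LevelSmall)
open MinimalActionLevels (perWin)
open BlockAverageVaryHolo (nbRad)
open BlockAveragePushDirGauge (gaugeDir)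
open NE3HessForm (hess dAction)
open NE3TangentCovariantTower (dirIter)
open NE3EnergyShapes (IsUnitarySite IsPeriodicSite)
open NE3CovariantWeitzenbock (covDiv)
open NE3RightInverseSupLetters (frameC supC corrC)
open NE3QbarIterCovLiftPrep (cruxC)
open NE3RightInverseSolveLetters (thetaLoc cruxC_nonneg)
open NE3HatInvCurlLetters (curl1C)
open BlockAverageVaryDisc (rho0)
open NE3LinearisedAverageSup (curvSum)
open NE3ResidualSliceRep (dirIter_sub)
open NE3.CurvedLandauRep (exists_landauRep_W)
open AveragingDeficitTransport (norm_Ad_of_unitary mem_U1_of_unitary)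
open NE3AxialGaugeLadder (smallField_gaugeAct)
open NE3CovariantCalculus (cD cDstar)
open NE7ApeCurvedRepPointedGaugeFourTerm (smallField_of_tanCritical_pointedGauge_fourTerm)
open NE7SameTopNormalLift (exists_normalLift_sameTop)
open NE7ApeCurvedRepRoadBFinal (norm_grad_structured_le)
open NE7CovariantTentExtension (exists_tent_extension)
open NE7CurvedRemainderCodifferential (norm_cD_le)
open NE7GradientCurrencyCurvedSharp (norm_gradMember_le_periodic_sharp)
open NE7RelPlaqCodifferentialBounds (norm_codiff_relPlaq_le_of_covDiv_bounds)

open NE3.PairLandauB8 (IsLandauB8)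

noncomputable section

variable {d : ℕ} {n : Type*} [Fintype n] [DecidableEq n]

/-- **ROAD (B) WITH THE GRADIENT LETTER DISCHARGED (SHARP), FOUR-TERM SLICE-SOLVER LETTER** — `NE7ApeCurvedRepRoadBGradientSharpH.smallField_of_tanCritical_roadB_gradientSharp`
with `(S, hS, hG)` ↦ the four-term letter `h4`, `hDivCorr` (`d_C`, tent structure) displayed, E′'s divergence clause (already used here for the gradient member) and F111 + the crude
`2d·a_N` DISCHARGING the root's divergence datum; conclusion = the original radius `+ K_D·(d_C + (b₀ + 3c_RE b₀) + 2d·a_N) + K_Ξ·2θ_u`. [folklore] -/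
theorem smallField_of_tanCritical_roadB_gradientSharp_fourTerm [Nonempty n] (hd : 2 ≤ d) {L N : ℕ} [NeZero N] (hL : 2 ≤ L) (j : ℕ)
    -- the background
    {W : Site d → Fin d → (Matrix n n ℂ)ˣ} {x : ℝ} (hWu : IsUnitaryCfg W) (hWP : IsPeriodicCfg W ((N * L ^ (j + 1) : ℕ) : ℤ))
    (hx : 0 ≤ x) (hs : LevelSmall d L j x) (hWx : SmallField W x)
    -- the sup radius of the representative and the regime at `x′ = x + 4(e^{α₀} − 1)`
    {α₀ : ℝ} (hα0 : 0 ≤ α₀) (hs' : LevelSmall d L j (x + 4 * (Real.exp α₀ - 1)))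
    (hθ : cruxC d L * (((L : ℝ) ^ (j + 1)) ^ 2 * (x + 4 * (Real.exp α₀ - 1))) < 1)
    (hθl : thetaLoc d L * (((L : ℝ) ^ (j + 1)) ^ 2 * (x + 4 * (Real.exp α₀ - 1))) < 1)
    (hε : ((L : ℝ) ^ (j + 1)) ^ 2 * (x + 4 * (Real.exp α₀ - 1)) ≤ 1)
    -- the field: of the class, tangent-critical, over `W`'s datum
    {U : Site d → Fin d → (Matrix n n ℂ)ˣ} (hUu : IsUnitaryCfg U) (hUP : IsPeriodicCfg U ((N * L ^ (j + 1) : ℕ) : ℤ))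
    {xU : ℝ} (hxU : 0 ≤ xU) (hsU : LevelSmall d L j xU) (hUxU : SmallField U xU)
    (hcritU : ∀ Y : Site d → Fin d → Matrix n n ℂ, IsSkewDir Y → IsPeriodicDir Y ((N * L ^ (j + 1) : ℕ) : ℤ) →
      dirIter L (j + 1) U Y = 0 → dAction U Y (perWin d (N * L ^ (j + 1))) = 0)
    (hTopUW : cavgIter L (j + 1) U = cavgIter L (j + 1) W)
    -- row NE3's class data of `W` and E′'s initial gauge ∕ regime (as in `exists_landauRep_W`), the constant `c_RE` named; road (B)'s two extra regime lines
    {x₁ : ℝ} (hx10 : 0 ≤ x₁)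
    (hgrad : ∀ (p : Site d) (μ κ : Fin d), κ ≠ μ →
      ‖Ad (W p μ) ((hol W (p + e μ) (plaqWord κ μ) : (Matrix n n ℂ)ˣ) : Matrix n n ℂ) - ((hol W p (plaqWord κ μ) : (Matrix n n ℂ)ˣ) : Matrix n n ℂ)‖ ≤ x₁)
    (hbx : 23040 * (d : ℝ) ^ 4 * (frameC d L + d) ^ 2 * ((L : ℝ) ^ (j + 1)) ^ 2 * x ≤ 1)
    (hcx : 11520 * (d : ℝ) ^ 4 * (frameC d L + d) ^ 3 * ((L : ℝ) ^ (j + 1)) ^ 3 * x₁ ≤ 1)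
    (hbx' : 256 * (d : ℝ) ^ 2 * ((L : ℝ) ^ (j + 1)) ^ 2 * x ≤ 1) (hcx' : 16 * (d : ℝ) * ((L : ℝ) ^ (j + 1)) ^ 3 * x₁ ≤ 1)
    {r₀ b₀ : ℝ} (hr₀ : ∀ (y : Site d) (μ : Fin d), ‖(((W y μ)⁻¹ * U y μ : (Matrix n n ℂ)ˣ) : (Matrix n n ℂ)) - 1‖ ≤ r₀)
    (hb₀ : ∀ x : Site d, ‖covDiv W (fun y μ => mlog (((W y μ)⁻¹ * U y μ : (Matrix n n ℂ)ˣ) : (Matrix n n ℂ))) x‖ ≤ b₀)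
    {cRE : ℝ} (hcRE : cRE = 1 + 2 * (Fintype.card n : ℝ) * (64 * (d : ℝ) ^ 2 * N) ^ d + 27 * (Fintype.card n : ℝ) ^ 3 * (512 : ℝ) ^ d * (N : ℝ) ^ d)
    (hreg₁ : (36 * (d : ℝ) * (frameC d L + d) ^ 2) * ((L : ℝ) ^ (j + 1)) ^ 2 * (cRE * b₀) ≤ 1 / 10)
    (hreg₂ : (36 * (d : ℝ) * (frameC d L + d)) * (L : ℝ) ^ (j + 1) * (cRE * b₀) ≤ 1 / 25)
    (hreg₃ : r₀ + 5 / 2 * ((36 * (d : ℝ) * (frameC d L + d)) * (L : ℝ) ^ (j + 1) * (cRE * b₀)) ≤ 1 / 20)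
    (hline : cRE * (4 * ((36 * (d : ℝ) * (frameC d L + d) ^ 2) * ((L : ℝ) ^ (j + 1)) ^ 2) * (b₀ + 4 * (cRE * b₀))
        + 25 * d * (r₀ + 5 / 2 * ((36 * (d : ℝ) * (frameC d L + d)) * (L : ℝ) ^ (j + 1) * (cRE * b₀))) * ((36 * (d : ℝ) * (frameC d L + d)) * (L : ℝ) ^ (j + 1))
        + 14 * d * ((36 * (d : ℝ) * (frameC d L + d)) * (L : ℝ) ^ (j + 1)) ^ 2 * (cRE * b₀)) ≤ 1 / 2)
    -- E′'s radii named: `α_E`, `θ_u`; the tent extension's `δ = corrC∕M·2θ_u`; road (B)'s regime `α_E ≤ 1∕40`, `θ_u ≤ 1∕160`, `δ ≤ 1∕40`, `α₀ ≥ α_E + δ + 4(2θ_u+δ)(α_E+δ)`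
    {αE θu : ℝ} (hαE : αE = 2 * (r₀ + 5 / 2 * ((36 * (d : ℝ) * (frameC d L + d)) * (L : ℝ) ^ (j + 1) * (cRE * b₀))))
    (hθu : θu = 4 * ((36 * (d : ℝ) * (frameC d L + d) ^ 2) * ((L : ℝ) ^ (j + 1)) ^ 2 * (cRE * b₀)))
    (hαE40 : αE ≤ 1 / 40) (hθu160 : θu ≤ 1 / 160)
    {δ : ℝ} (hδ : δ = corrC d / (L : ℝ) ^ (j + 1) * (2 * θu)) (hδ40 : δ ≤ 1 / 40) (hα₀ : αE + δ + 4 * (2 * θu + δ) * (αE + δ) ≤ α₀)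
    -- the remaining analytic letters at `W`: (L1)′ and α₁ for the SAME-TOP structured fields of radius `α₀`, (L2), (L3) discharged
    -- (L1)′ DISCHARGED (F111): the quadratic-remainder regime, the slice `S` containing the `W`-tangent skew periodic fields, and the names `c_N = 4m`, `ν = 24·#Plane·m`
    (hs1 : LevelSmall d L (j + 1) x) (hA : curvSum d L (j + 1) x ≤ 2 / 3 * L) (hσ0 : 4 * (3 + 12 * (d : ℝ)) ^ 2 * (L : ℝ) ^ (j + 1) * α₀ ≤ rho0 d L ^ 2)
    {cN aN dC KG KX KD KΞ ν : ℝ}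
    -- the pointing correction's divergence letter (memo O2: face-supported; displayed until priced), for the TENT extension's structure constants
    (hDivCorr : ∀ (Z : Site d → Fin d → Matrix n n ℂ) (σ : Site d → Matrix n n ℂ) (Z' : Site d → Fin d → Matrix n n ℂ),
      IsSkewDir Z → IsPeriodicDir Z ((N * L ^ (j + 1) : ℕ) : ℤ) → IsLandauB8 (d := d) L N (j + 1) W Z → (∀ y μ, ‖Z y μ‖ ≤ αE) →
      (∀ y, σ y ∈ skewAdjoint (Matrix n n ℂ)) → (∀ (y : Site d) (i : Fin d), σ (y + ((N * L ^ (j + 1) : ℕ) : ℤ) • e i) = σ y) →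
      (∀ y, ‖σ y‖ ≤ 2 * θu) → (∀ (y : Site d) (κ : Fin d), ‖gaugeDir W σ y κ‖ ≤ δ) →
      IsSkewDir Z' → IsPeriodicDir Z' ((N * L ^ (j + 1) : ℕ) : ℤ) →
      (∀ y μ, ‖Z' y μ‖ ≤ α₀) → cavgIter L (j + 1) (vary W Z' 1) = cavgIter L (j + 1) W →
      (∀ (y : Site d) (μ : Fin d), ‖Z' y μ - (Z y μ - gaugeDir W σ y μ)‖ ≤ 4 * (2 * θu + δ) * (αE + δ)) →
      ∀ y : Site d, ‖covDiv W (fun z κ => Z' z κ - (Z z κ - gaugeDir W σ z κ)) y‖ ≤ dC)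
    (haN : aN = (supC d L / ((L : ℝ) ^ (j + 1) * (1 - cruxC d L * (((L : ℝ) ^ (j + 1)) ^ 2 * x)))
        * (4 * (3 + 12 * (d : ℝ)) ^ 3 / rho0 d L ^ 2 * ((L : ℝ) ^ (j + 1) * α₀) ^ 2)))
    (hcN : cN = 4 * (supC d L / ((L : ℝ) ^ (j + 1) * (1 - cruxC d L * (((L : ℝ) ^ (j + 1)) ^ 2 * x)))
        * (4 * (3 + 12 * (d : ℝ)) ^ 3 / rho0 d L ^ 2 * ((L : ℝ) ^ (j + 1) * α₀) ^ 2)))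
    (hνm : ν = 24 * (Fintype.card (T4AveragingDeficitWall.Plane d) : ℝ) * (supC d L / ((L : ℝ) ^ (j + 1) * (1 - cruxC d L * (((L : ℝ) ^ (j + 1)) ^ 2 * x)))
        * (4 * (3 + 12 * (d : ℝ)) ^ 3 / rho0 d L ^ 2 * ((L : ℝ) ^ (j + 1) * α₀) ^ 2)))
    -- THE GRADIENT LETTER DISCHARGED (sharp): a radius `R ≥ 1` with `16dR·2d(R+1)x + 32dR(e^{4α_E} − 1) ≤ 1` and the (1.9)-TYPE flux-divergence radii of `U`, `W`
    {R : ℕ} (hR : 1 ≤ R) (hsmall : 16 * (d : ℝ) * R * (2 * (d : ℝ) * (R + 1) * x) + 32 * (d : ℝ) * R * (Real.exp (4 * αE) - 1) ≤ 1)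
    {jU jW : ℝ} (hjU : ∀ (ν : Fin d) (y : Site d), ‖B8Ineq132.covDiv 1 U ν y‖ ≤ jU) (hjW : ∀ (ν : Fin d) (y : Site d), ‖B8Ineq132.covDiv 1 W ν y‖ ≤ jW)
    -- THE FOUR-TERM SLICE-SOLVER LETTER (F152's shape) on all skew periodic `W`-tangent fields
    (h4 : ∀ X : Site d → Fin d → Matrix n n ℂ, IsSkewDir X →
      IsPeriodicDir X ((N * L ^ (j + 1) : ℕ) : ℤ) → dirIter L (j + 1) W X = 0 → ∀ R : ℝ, (∀ y κ', ‖X y κ'‖ ≤ R) → ∀ g : ℝ, 0 ≤ g →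
      (∀ Y : Site d → Fin d → Matrix n n ℂ, IsSkewDir Y → IsPeriodicDir Y ((N * L ^ (j + 1) : ℕ) : ℤ) → dirIter L (j + 1) W Y = 0 →
        |hess W X Y (perWin d (N * L ^ (j + 1)))| ≤ g * dirL1 Y (periodBox (d := d) (N * L ^ (j + 1)))) →
      ∀ σ' : Site d → Matrix n n ℂ, (∀ y, σ' y ∈ skewAdjoint (Matrix n n ℂ)) →
      (∀ (y : Site d) (i : Fin d), σ' (y + ((N * L ^ (j + 1) : ℕ) : ℤ) • e i) = σ' y) → ∀ Ξ' : ℝ, (∀ y, ‖σ' y‖ ≤ Ξ') →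
      ∀ D : ℝ, (∀ y, ‖covDiv W (fun z κ => X z κ + gaugeDir W σ' z κ) y‖ ≤ D) →
      ∀ z μ' ν', μ' ≠ ν' → ‖curlAt W X z μ' ν'‖ ≤ KG * g + KX * R + KD * D + KΞ * Ξ')
    (hcritW : ∀ Y : Site d → Fin d → Matrix n n ℂ, IsSkewDir Y → IsPeriodicDir Y ((N * L ^ (j + 1) : ℕ) : ℤ) → dirIter L (j + 1) W Y = 0 →
      dAction W Y (perWin d (N * L ^ (j + 1))) = 0) :
    SmallField U (x + (KG * (
        ((x + 4 * (Real.exp α₀ - 1))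
            * ((curl1C d L / (1 - thetaLoc d L * (((L : ℝ) ^ (j + 1)) ^ 2 * (x + 4 * (Real.exp α₀ - 1)))))
                * (((L : ℝ) ^ (j + 1)) ^ d / ((L : ℝ) ^ (j + 1)) ^ 2))
            * (Real.exp (((L : ℝ) ^ d / L) * ((d : ℝ) * (16 * ((d : ℝ) + 1) * ((d : ℝ) + 4) * (L : ℝ) ^ 2)
                  * (1250 * ((nbRad d L : ℝ) + L) + 8 * ((d : ℝ) * L) + 2 * L)) * (2 / twoLevelSmall d L))
                * ((L : ℝ) / (L : ℝ) ^ d) ^ j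
                * (((d : ℝ) * (2 * nbRad d L + 1) ^ d) * ((2 * (d : ℝ) + 4) * (L : ℝ) ^ 2) * (2 * (L : ℝ) ^ j) * (Real.exp α₀ - 1)
                  + (17 / 8 * ((L : ℝ) ^ 2) ^ j * (x + 4 * (Real.exp α₀ - 1)))
                    * (((d : ℝ) * (2 * nbRad d L + 1) ^ d) * ((2 * (d : ℝ) + 4)
                          * (2 * (2 * L * (nbRad d L : ℝ) + 128 * ((d : ℝ) + 1) * ((d : ℝ) + 4) * (L : ℝ) ^ 2)))
                      + ((d : ℝ) * (2 * nbRad d L + 1) ^ d) * ((2 * (d : ℝ) + 4) * (L : ℝ) ^ 2 * (2 * (nbRad d L : ℝ))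
                          + 2 * (8 * (L : ℝ) + (1250 * ((nbRad d L : ℝ) + L) + 8 * (d * L) + 2 * L))
                              * (16 * ((d : ℝ) + 1) * ((d : ℝ) + 4) * (L : ℝ) ^ 2))))))
        + (Fintype.card (T4AveragingDeficitWall.Plane d) : ℝ)
          * (2 * (240 * (Real.exp α₀ - 1) * α₀ * (2 * ((4 * ((d : ℝ) * αE / R + R * ((jU + jW + d * (2 * (Real.exp αE - 1) * xU + 2 * (xU * x) + 2 * (x * (2 + x) * x) + 2 * (xU * (2 + xU) * xU))) + 2 * (b₀ + 3 * (cRE * b₀)))) + (4 * R * (8 * d * (Real.exp (4 * αE) - 1) * x + 10 * d * x + 2 * (2 * (d : ℝ) ^ 2 * (R + 1) * x₁ + 8 * (d : ℝ) ^ 3 * ((R : ℝ) + 1) ^ 2 * x ^ 2) + 12 * d * (2 * (d : ℝ) * (R + 1) * x) ^ 2) + 4 * (2 * (d : ℝ) * (R + 1) * x)) * αE + 2 * x * αE) + 2 * δ + 2 * (4 * (2 * θu + δ) * (αE + δ))) + 24 * α₀ * (Real.exp α₀ - 1) + x) + 8 * α₀ * (2 * ((4 * ((d : ℝ) * αE /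 R + R * ((jU + jW + d * (2 * (Real.exp αE - 1) * xU + 2 * (xU * x) + 2 * (x * (2 + x) * x) + 2 * (xU * (2 + xU) * xU))) + 2 * (b₀ + 3 * (cRE * b₀)))) + (4 * R * (8 * d * (Real.exp (4 * αE) - 1) * x + 10 * d * x + 2 * (2 * (d : ℝ) ^ 2 * (R + 1) * x₁ + 8 * (d : ℝ) ^ 3 * ((R : ℝ) + 1) ^ 2 * x ^ 2) + 12 * d * (2 * (d : ℝ) * (R + 1) * x) ^ 2) + 4 * (2 * (d : ℝ) * (R + 1) * x)) * αE + 2 * x * αE) + 2 * δ + 2 * (4 * (2 * θu + δ) * (αE + δ))) + 24 * α₀ * (Real.exp α₀ - 1))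
              + 6 * (Real.exp α₀ - 1) * (2 * ((4 * ((d : ℝ) * αE / R + R * ((jU + jW + d * (2 * (Real.exp αE - 1) * xU + 2 * (xU * x) + 2 * (x * (2 + x) * x) + 2 * (xU * (2 + xU) * xU))) + 2 * (b₀ + 3 * (cRE * b₀)))) + (4 * R * (8 * d * (Real.exp (4 * αE) - 1) * x + 10 * d * x + 2 * (2 * (d : ℝ) ^ 2 * (R + 1) * x₁ + 8 * (d : ℝ) ^ 3 * ((R : ℝ) + 1) ^ 2 * x ^ 2) + 12 * d * (2 * (d : ℝ) * (R + 1) * x) ^ 2) + 4 * (2 * (d : ℝ) * (R + 1) * x)) * αE + 2 * x * αE) + 2 * δ + 2 * (4 * (2 * θu + δ) * (αE + δ))) + 24 * (Real.exp α₀ - 1) * α₀)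
              + (2 * ((4 * ((d : ℝ) * αE / R + R * ((jU + jW + d * (2 * (Real.exp αE - 1) * xU + 2 * (xU * x) + 2 * (x * (2 + x) * x) + 2 * (xU * (2 + xU) * xU))) + 2 * (b₀ + 3 * (cRE * b₀)))) + (4 * R * (8 * d * (Real.exp (4 * αE) - 1) * x + 10 * d * x + 2 * (2 * (d : ℝ) ^ 2 * (R + 1) * x₁ + 8 * (d : ℝ) ^ 3 * ((R : ℝ) + 1) ^ 2 * x ^ 2) + 12 * d * (2 * (d : ℝ) * (R + 1) * x) ^ 2) + 4 * (2 * (d : ℝ) * (R + 1) * x)) * αE + 2 * x * αE) + 2 * δ + 2 * (4 * (2 * θu + δ) * (αE + δ))) + 24 * (Real.exp α₀ - 1) * α₀) * (2 * ((4 * ((d : ℝ) * αE / R + R * ((jU + jW + d * (2 * (Real.exp αE - 1) * xU + 2 * (xU * x) + 2 * (x * (2 + x) * x) + 2 * (xU * (2 + xU) * xU))) + 2 * (b₀ + 3 * (cRE * b₀)))) + (4 * R * (8 * d * (Real.exp (4 * αE) - 1) * x + 10 * d * x + 2 * (2 * (d : ℝ) ^ 2 * (R + 1) * x₁ + 8 *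 (d : ℝ) ^ 3 * ((R : ℝ) + 1) ^ 2 * x ^ 2) + 12 * d * (2 * (d : ℝ) * (R + 1) * x) ^ 2) + 4 * (2 * (d : ℝ) * (R + 1) * x)) * αE + 2 * x * αE) + 2 * δ + 2 * (4 * (2 * θu + δ) * (αE + δ))) + 24 * α₀ * (Real.exp α₀ - 1))
              + 960 * (Real.exp α₀ - 1) * α₀ ^ 2 + 32 * x * α₀ ^ 2)
            + (64 * α₀ * ((4 * ((d : ℝ) * αE / R + R * ((jU + jW + d * (2 * (Real.exp αE - 1) * xU + 2 * (xU * x) + 2 * (x * (2 + x) * x) + 2 * (xU * (2 + xU) * xU))) + 2 * (b₀ + 3 * (cRE * b₀)))) + (4 * R * (8 * d * (Real.exp (4 * αE) - 1) * x + 10 * d * x + 2 * (2 * (d : ℝ) ^ 2 * (R + 1) * x₁ + 8 * (d : ℝ) ^ 3 * ((R : ℝ) + 1) ^ 2 * x ^ 2) + 12 * d * (2 * (d : ℝ) * (R + 1) * x) ^ 2) + 4 * (2 * (d : ℝ) * (R + 1) * x)) * αE + 2 * x * αE) + 2 * δ + 2 * (4 * (2 * θu + δ) * (αE + δ))) + 1024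 * x * α₀ ^ 2))
        + ν) + KX * (α₀ + aN) + KD * (dC + (b₀ + 3 * (cRE * b₀)) + 2 * (d : ℝ) * aN) + KΞ * (2 * θu) + cN + 28 * α₀ ^ 2)) := by
  have hd1 : 1 ≤ d := by omega
  have hL1 : 1 ≤ L := by omega
  have hPper : 1 ≤ N * L ^ (j + 1) := Nat.mul_pos (Nat.pos_of_ne_zero (NeZero.ne N)) (Nat.pow_pos (by omega))
  -- the right-inverse regime at `x` from the one at `x′ ≥ x`
  have hexp : 0 ≤ 4 * (Real.exp α₀ - 1) := by have := Real.add_one_le_exp α₀; linarith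
  have hM2 : 0 ≤ ((L : ℝ) ^ (j + 1)) ^ 2 := by positivity
  have hxx' : ((L : ℝ) ^ (j + 1)) ^ 2 * x ≤ ((L : ℝ) ^ (j + 1)) ^ 2 * (x + 4 * (Real.exp α₀ - 1)) :=
    mul_le_mul_of_nonneg_left (by linarith) hM2
  have hθx : cruxC d L * (((L : ℝ) ^ (j + 1)) ^ 2 * x) < 1 :=
    (mul_le_mul_of_nonneg_left hxx' (cruxC_nonneg d L)).trans_lt hθ
  have hεx : ((L : ℝ) ^ (j + 1)) ^ 2 * x ≤ 1 := hxx'.trans hε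
  have h1θ : 0 < 1 - cruxC d L * (((L : ℝ) ^ (j + 1)) ^ 2 * x) := by linarith
  have hsupC0 : 0 ≤ supC d L := by
    unfold supC NE3RightInverseSupLetters.corrC NE3RightInverseSupLetters.frameC; have := NE3QbarIterCovLiftPrep.liftC_nonneg d; positivity
  have hν : 0 ≤ ν := by rw [hνm]; positivity
  -- signs of the named radii (kept as atoms: no `subst` of the long constants)
  have hb0 : 0 ≤ b₀ := (norm_nonneg _).trans (hb₀ 0)
  have hr0 : 0 ≤ r₀ := (norm_nonneg _).trans (hr₀ 0 ⟨0, by omega⟩)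
  have hfr : 0 ≤ frameC d L := by unfold frameC; positivity
  have hc0 : 0 ≤ corrC d := zero_le_one.trans (NE3RightInverseSupLetters.one_le_corrC d)
  have hcRE0 : 0 ≤ cRE := by rw [hcRE]; positivity
  have hθu0 : 0 ≤ θu := by rw [hθu]; positivity
  have hαE0 : 0 ≤ αE := by rw [hαE]; positivity
  have hδ0 : 0 ≤ δ := by rw [hδ]; positivity
  have hjU0 : 0 ≤ jU := (norm_nonneg _).trans (hjU ⟨0, by omega⟩ 0)
  have hjW0 : 0 ≤ jW := (norm_nonneg _).trans (hjW ⟨0, by omega⟩ 0)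
  have ht40 : 2 * θu ≤ 1 / 40 := by linarith only [hθu160]
  have hθu4 : θu ≤ 1 / 4 := by linarith only [hθu160]
  -- E′ (regime lines with the constant spelled out; outputs folded back into the atoms `cRE`, `αE`, `θu`)
  rw [hcRE] at hreg₁ hreg₂ hreg₃ hline
  obtain ⟨u, Z, huU, huP, hZs, hZP, hrep, hLan, -, hZsup, hu1, hcov⟩ :=
    exists_landauRep_W hd1 hL j hWu hWP hx hs hWx hx10 hgrad hbx hcx hbx' hcx' hUu hUP hr₀ hb₀ hreg₁ hreg₂ hreg₃ hline
  rw [← hcRE] at hZsup hu1 hcov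
  rw [← hαE] at hZsup
  rw [← hθu] at hu1
  -- THE GRADIENT MEMBER OF `Z` from F121 + F122b: the relative-plaquette datum against the radii `j_U` (gauge invariance of (1.2)) and `j_W`, the divergence
  -- gradient from E′'s reaction
  have hu1' : ∀ y, u y ∈ U1 (Matrix n n ℂ) := fun y => mem_U1_of_unitary (huU y)
  have hjU' : ∀ (ν' : Fin d) (y : Site d), ‖B8Ineq132.covDiv 1 (gaugeAct u U) ν' y‖ ≤ jU := fun ν' y => by
    rw [B8Ineq132.norm_covDiv_gaugeAct 1 hu1' U ν' y]; exact hjU ν' y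
  have hP : ∀ (y : Site d) (ν' : Fin d), ‖cD W ν' (covDiv W Z) y‖ ≤ 2 * (b₀ + 3 * (cRE * b₀)) := fun y ν' =>
    (norm_cD_le hWu ν' (covDiv W Z) y).trans ((add_le_add (hcov _) (hcov _)).trans (le_of_eq (two_mul _).symm))
  have hGradZ := norm_gradMember_le_periodic_sharp hd1 hPper hWu hx hx10 hWx hgrad hWP Z hZP hZsup
    (fun y ν' => norm_codiff_relPlaq_le_of_covDiv_bounds hWu hx hWx hZs hZsup hrep hxU (smallField_gaugeAct huU hUxU) hjU' hjW y ν') hP hR hsmall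
  -- `0 ≤ α₁` read off the gradient bound itself (no arithmetic on the long expression)
  have hα1 := add_nonneg (add_nonneg ((norm_nonneg _).trans (hGradZ 0 ⟨0, by omega⟩ ⟨0, by omega⟩)) (mul_nonneg zero_le_two hδ0))
    (mul_nonneg zero_le_two (mul_nonneg (mul_nonneg (by norm_num : (0 : ℝ) ≤ 4) (add_nonneg (mul_nonneg zero_le_two hθu0) hδ0)) (add_nonneg hαE0 hδ0)))
  -- F114: the covariant tent extension of `u`'s corner values; the name `δ`
  obtain ⟨σ, hσs, hσP, hext, hσt, hσδ⟩ :=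
    exists_tent_extension hL N j hWu hWP hx hs hWx hεx huU huP hu1 hθu4
  subst hδ
  -- F108 with (L1)′ by F111 and α₁ by the three-term split
  refine smallField_of_tanCritical_pointedGauge_fourTerm hd hL j hWu hWP hx hs hWx hα0 hs' hθ hθl hε hUu hUP hxU hsU hUxU hcritU hTopUW huU huP hrep hZsup hαE40
    hσs hσP hext hσt hσδ ht40 hδ40 hα₀ hν hcov
    (fun Z' hZ's hZ'P hZ'α hTop hstr => hDivCorr Z σ Z' hZs hZP hLan hZsup hσs hσP hσt hσδ hZ's hZ'P hZ'α hTop hstr) ?_ hα1 ?_ h4 hcritW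
  · -- (L1)′ by F111, with the normal lift's skewness and the CRUDE divergence bound `‖covDiv W A_N‖ ≤ 2d·a_N` (memo O2(ii))
    intro Z' hZ's hZ'P hZ'α hTop _
    obtain ⟨AN, hANs, hANP, hANex, hANsup, hANcurl, hANhess⟩ :=
      exists_normalLift_sameTop hL j hWu hWP hx hs hs1 hWx hθx hεx hA hZ's hZ'P hα0 hZ'α hσ0 hTop
    have hANsup' : ∀ (y : Site d) (μ : Fin d), ‖AN y μ‖ ≤ aN := fun y μ => by rw [haN]; exact hANsup y μ
    refine ⟨AN, hANP, hANsup', hANex, fun z μ' ν' hne => ?_, fun Y _ hYP _ => ?_, hANs, fun y => ?_⟩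
    · rw [hcN]; exact hANcurl z μ' ν' hne
    · rw [hνm]; exact hANhess Y hYP
    · unfold NE3CovariantWeitzenbock.covDiv
      calc ‖∑ μ : Fin d, (Ad (W y μ) (AN y μ) - AN (y - e μ) μ)‖
          ≤ ∑ μ : Fin d, ‖Ad (W y μ) (AN y μ) - AN (y - e μ) μ‖ := norm_sum_le _ _
        _ ≤ ∑ _μ : Fin d, (aN + aN) := Finset.sum_le_sum fun μ _ =>
            (norm_sub_le _ _).trans (add_le_add (by rw [norm_Ad_of_unitary (hWu y μ)]; exact hANsup' y μ) (hANsup' _ μ))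
        _ = 2 * (d : ℝ) * aN := by rw [Finset.sum_const, Finset.card_univ, Fintype.card_fin, nsmul_eq_mul]; ring
  · intro Z' _ _ _ _ hstr y κ τ
    have h := norm_grad_structured_le (hWu (y + e κ) τ) (Z (y + e τ) κ) (Z y κ) (gaugeDir W σ (y + e τ) κ) (gaugeDir W σ y κ) (Z' (y + e τ) κ) (Z' y κ)
    refine h.trans ((add_le_add (add_le_add (hGradZ y κ τ) (add_le_add (hσδ (y + e τ) κ) (hσδ y κ)))
      (add_le_add (hstr (y + e τ) κ) (hstr y κ))).trans (le_of_eq ?_))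
    ring

end

end Summit.QuantumFields.BalabanUV.T4Continuum.NE7ApeCurvedRepRoadBGradientSharpFourTerm
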